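import Summits.Schanuel.Schanuel.Theorems.RootDecomp1KHyper07

/-!
# RootDecomp1KHyper — part 8 of the «HyperCarving» port wave (lens 6, gen 9 = ROUND 4 of route-Schanuel-RootDecomp1K; 19 parts planned)

Mechanical port (census-1 gen 7, dependency closure; tools census/tools/gen7/portkit2.py + build_l6g9.py) of §17 of HOME/decomp-schanuel-lens-6/g9/HyperCarving.lean
(sha256 aba5c91f…, 8041 l; critic CLEARED FOR TYPING 2026-08-30T13:33:07Z; writer PATH A″ rev 5–8) together with the §§0–16 declarations it depends on
(nothing of the node was in the tree before except RootDecomp1KLinLiouvilleSplit and the Literature fact NesterenkoWaldschmidt1996_thm_5_1).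
This part: node lines 4178–4602 (8 declarations: algebraicIndependent_exp_of_hyperLiouville, ex3, co3, A3, F3, F3_cast …).
All parts share the namespace `Summit.Schanuel.Schanuel.Theorems.RootDecomp1KHyper` (node sub-namespace `HyperCell` reproduced); statements and proofs
are the node's verbatim; `--supports stmt-Schanuel-33363` (A₄ʰ HyperLiouvilleSchanuel). Sorry-free; standard axioms. Nothing here proves Schanuel; rung 0.
-/

set_option linter.dupNamespace false
set_option linter.unusedSectionVars false

noncomputable section

open Complex IntermediateField Filter Polynomial

namespace Summit.Schanuel.Schanuel.Theorems.RootDecomp1KHyper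

variable {n K : ℕ}

namespace HyperCell

variable {n K : ℕ}

/-- §16b. Roots: a root within ‖A(w)‖^{1/N}, Gauss, Mahler: auxiliary statement `one_le_mahlerMeasure_map_of_ne_zero` (lens 6 gen 9 node, ported verbatim). -/
private theorem one_le_mahlerMeasure_map_of_ne_zero {R : ℤ[X]} (hR : R ≠ 0) :
    1 ≤ (R.map (Int.castRingHom ℂ)).mahlerMeasure := by
  refine one_le_mahlerMeasure_of_one_le_norm_leadingCoeff ?_
  rw [Polynomial.leadingCoeff_map_of_injective (RingHom.injective_int _), eq_intCast,
    Complex.norm_intCast]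
  exact_mod_cast Int.one_le_abs (Polynomial.leadingCoeff_ne_zero.mpr hR)

/-- §16b. Roots: a root within ‖A(w)‖^{1/N}, Gauss, Mahler: auxiliary statement `mahlerMeasure_le_of_dvd` (lens 6 gen 9 node, ported verbatim). -/
private theorem mahlerMeasure_le_of_dvd {Q A : ℤ[X]} (hdvd : Q ∣ A) (hA : A ≠ 0) :
    (Q.map (Int.castRingHom ℂ)).mahlerMeasure ≤ (A.map (Int.castRingHom ℂ)).mahlerMeasure := by
  obtain ⟨R, rfl⟩ := hdvd
  have hR : R ≠ 0 := right_ne_zero_of_mul hA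
  rw [Polynomial.map_mul, mahlerMeasure_mul]
  calc (Q.map (Int.castRingHom ℂ)).mahlerMeasure = (Q.map (Int.castRingHom ℂ)).mahlerMeasure * 1 :=
        (mul_one _).symm
    _ ≤ _ := mul_le_mul_of_nonneg_left (one_le_mahlerMeasure_map_of_ne_zero hR)
        (mahlerMeasure_nonneg _)

/-- §16c. Numerical lemmas: auxiliary statement `log_le_self_of_nonneg` (lens 6 gen 9 node, ported verbatim). -/
private theorem log_le_self_of_nonneg {x : ℝ} (h0 : 0 ≤ x) : Real.log x ≤ x := by
  rcases eq_or_lt_of_le h0 with h | h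
  · rw [← h, Real.log_zero]
  · linarith [Real.log_le_sub_one_of_pos h]

/-- §16d. The theorem: auxiliary statement `eval_map_intCast` (lens 6 gen 9 node, ported verbatim). -/
private theorem eval_map_intCast (P : ℤ[X]) (x : ℂ) : (P.map (Int.castRingHom ℂ)).eval x = aeval x P := by
  rw [Polynomial.eval_map, Polynomial.aeval_def, algebraMap_int_eq]

/-- **Theorem (cell «hyper-Liouville exponent», mod the support statement `hX`).**
For a hyper-Liouville real `ρ`, the numbers `ρ` and `e^ρ` are algebraically independent over `ℚ`.
Proof = Liouville extraction in the EXPONENT: a relation `Σ_k G_k(ρ) e^{kρ} = 0` specialised at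
`ρ ≈ p/q` gives `A = Σ_k q^D G_k(p/q) Y^k ∈ ℤ[Y]` with `|A(e^ρ)| ≤ q^D M |ρ − p/q|`, hence a root
`ξ` of `A` with `|e^ρ − ξ| ≤ |A(e^ρ)|^{1/K}`; `ξ` is algebraic of degree `≤ K` and height
`O(D log q)`, so the measure gives `|e^{p/q} − ξ| ≥ exp(−c q³)` — against
`|e^{p/q} − ξ| ≤ 2e^{|ρ|}|ρ − p/q| + |e^ρ − ξ| ≤ exp(−q^m / K + O(log q))`. -/
theorem algebraicIndependent_exp_of_hyperLiouville (hX : ExplicitRatExpApprox) {ρ : ℝ}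
    (hρ : HyperLiouville ρ) : AlgebraicIndependent ℚ ![(ρ : ℂ), cexp ρ] := by
  by_contra hdep
  have hρt : Transcendental ℚ (ρ : ℂ) := transcendental_ofReal_of_liouville hρ.liouville
  obtain ⟨K, G, hGK, hrel⟩ := exists_int_relation hρt hdep
  set w : ℂ := cexp ρ with hw
  -- `K ≥ 1`: a relation of degree `0` in `w` would make `ρ` algebraic
  have hK1 : 1 ≤ K := by
    rcases Nat.eq_zero_or_pos K with hK0 | hK0
    · subst hK0
      exfalso
      have hl : (Fin.last 0 : Fin (0 + 1)) = 0 := by ext; simp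
      rw [hl] at hGK
      have h0 : aeval (ρ : ℂ) (G 0) = 0 := by simpa [Fin.sum_univ_succ] using hrel
      exact hρt ((IsFractionRing.isAlgebraic_iff ℤ ℚ ℂ).mp ⟨G 0, hGK, h0⟩)
    · exact hK0
  -- uniform degree bound and coefficient mass of the relation
  set D : ℕ := Finset.univ.sup fun k => (G k).natDegree with hDdef
  have hD : ∀ k, (G k).natDegree ≤ D := fun k =>
    Finset.le_sup (f := fun k => (G k).natDegree) (Finset.mem_univ k)
  set S : ℤ := ∑ k : Fin (K + 1), ∑ i ∈ Finset.range (D + 1), |(G k).coeff i| with hSdef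
  have hS0 : 0 ≤ S := Finset.sum_nonneg fun _ _ => Finset.sum_nonneg fun _ _ => abs_nonneg _
  have hS0r : (0 : ℝ) ≤ S := by exact_mod_cast hS0
  set Sr : ℝ := (S : ℝ) + 1 with hSr
  have hSr1 : 1 ≤ Sr := by rw [hSr]; linarith
  -- Lipschitz constants of the coefficients `G_k` at `ρ`
  have hlip : ∀ k : Fin (K + 1), ∃ Mk : ℝ, 0 < Mk ∧ ∀ x : ℝ, |x - ρ| ≤ 1 →
      ‖aeval ((x : ℝ) : ℂ) (G k) - aeval (ρ : ℂ) (G k)‖ ≤ Mk * |x - ρ| := by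
    intro k
    obtain ⟨Mk, hMk0, hMk⟩ := exists_lipschitz_at_root
      ((G k).map (Int.castRingHom ℂ) - C (aeval (ρ : ℂ) (G k))) ρ (by simp [eval_map_intCast])
    refine ⟨Mk, hMk0, fun x hx => ?_⟩
    have := hMk x hx
    simpa [eval_map_intCast] using this
  choose Mk hMk0 hMk using hlip
  set Mtot : ℝ := ∑ k : Fin (K + 1), Mk k * ‖w‖ ^ (k : ℕ) with hMtot
  have hMtot0 : 0 ≤ Mtot := Finset.sum_nonneg fun k _ => by
    have := hMk0 k; positivity
  -- `G_K` has no root near `ρ` other than `ρ`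
  obtain ⟨δ₀, hδ₀, hball⟩ := exists_ball_eval_ne_zero ((G (Fin.last K)).map (Int.castRingHom ℂ))
    ((Polynomial.map_ne_zero_iff (RingHom.injective_int _)).mpr hGK) ρ
  -- constants of the endgame (depend on `ρ, K, G` only)
  set c0 : ℝ := 1280000000 * (|ρ| + 4) * (27 + 2 * |ρ|) ^ 2 with hc0
  set cY : ℝ := (D : ℝ) * (|ρ| + 2) + Real.log Sr + 3 with hcY
  have hlogSr : 0 ≤ Real.log Sr := Real.log_nonneg hSr1
  have hcY0 : 0 ≤ cY := by positivity
  set c : ℝ := c0 * ((K : ℝ) ^ 2 * (1 + K) ^ 2) * cY with hc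
  have hc0' : 0 ≤ c := by positivity
  set C : ℝ := (K : ℝ) * c + K + D + Mtot + |ρ| + 3 + |Real.log δ₀| with hC
  have hC0 : 0 ≤ C := by positivity
  set m : ℕ := ⌈C⌉₊ + 3 with hm
  -- the approximation `r = p/q`, `|ρ − r| < exp(−q^m)`, `q ≥ m`
  obtain ⟨r, hden, hne, hlt⟩ := hρ m
  set q : ℕ := r.den with hq
  set p : ℤ := r.num with hp
  have hq3 : 3 ≤ q := le_trans (by omega) hden
  have hq1 : 1 ≤ q := by omega
  have hq0 : q ≠ 0 := by omega
  have hq1r : (1 : ℝ) ≤ q := by exact_mod_cast hq1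
  have hq2r : (2 : ℝ) ≤ q := by exact_mod_cast (show 2 ≤ q by omega)
  have hq3r : (1 : ℝ) ≤ (q : ℝ) ^ 3 := one_le_pow₀ hq1r
  have hr0 : r ≠ 0 := by
    rintro rfl
    simp [hq] at hq3
  have hrq : (r : ℝ) = (p : ℝ) / q := by rw [hp, hq]; exact Rat.cast_def r
  have hrC : ((r : ℝ) : ℂ) = (p : ℂ) / q := by
    rw [hrq, Complex.ofReal_div, Complex.ofReal_intCast, Complex.ofReal_natCast]
  have habsp : |(p : ℝ)| ≤ (|ρ| + 1) * q := by
    have hq0r : (q : ℝ) ≠ 0 := by positivity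
    have h1 : (p : ℝ) = (r : ℝ) * q := by rw [hrq]; field_simp
    have h2 : |(r : ℝ)| ≤ |ρ| + 1 := by
      have := abs_sub_abs_le_abs_sub (r : ℝ) ρ
      rw [abs_sub_comm] at this
      have h3 : |ρ - r| ≤ 1 := by
        refine hlt.le.trans ?_
        rw [Real.exp_le_one_iff]
        have : (0 : ℝ) ≤ (q : ℝ) ^ m := by positivity
        linarith
      linarith
    rw [h1, abs_mul, Nat.abs_cast]
    exact mul_le_mul_of_nonneg_right h2 (by positivity)
  set η : ℝ := |ρ - r| with hη
  have hη0 : 0 < η := abs_pos.mpr (sub_ne_zero.mpr hne)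
  have hηlt : η < Real.exp (-((q : ℝ) ^ m)) := hlt
  have hη1 : η ≤ 1 := by
    refine hηlt.le.trans ?_
    rw [Real.exp_le_one_iff]
    have : (0 : ℝ) ≤ (q : ℝ) ^ m := by positivity
    linarith
  have hη1' : |(r : ℝ) - ρ| ≤ 1 := by rw [abs_sub_comm]; exact hη1
  -- `q^m` dominates: `C q³ ≤ q^m`
  have hpowC : C ≤ (q : ℝ) ^ ⌈C⌉₊ :=
    calc C ≤ ⌈C⌉₊ := Nat.le_ceil C
      _ ≤ (2 : ℝ) ^ ⌈C⌉₊ := by exact_mod_cast (Nat.lt_two_pow_self).le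
      _ ≤ (q : ℝ) ^ ⌈C⌉₊ := pow_le_pow_left₀ (by norm_num) hq2r _
  have hqm : C * (q : ℝ) ^ 3 ≤ (q : ℝ) ^ m := by
    rw [hm, pow_add]
    exact mul_le_mul_of_nonneg_right hpowC (by positivity)
  have hCqm : C ≤ (q : ℝ) ^ m := (le_mul_of_one_le_right hC0 hq3r).trans hqm
  have hηδ : η < δ₀ := by
    refine hηlt.trans_le ?_
    calc Real.exp (-((q : ℝ) ^ m)) ≤ Real.exp (Real.log δ₀) := Real.exp_le_exp.mpr (by
          have h1 := neg_abs_le (Real.log δ₀)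
          have h2 : |Real.log δ₀| ≤ C := by
            rw [hC]
            have : 0 ≤ (K : ℝ) * c + K + D + Mtot + |ρ| + 3 := by positivity
            linarith
          linarith)
      _ = δ₀ := Real.exp_log hδ₀
  -- the specialised polynomial `A = Σ_k q^D G_k(p/q) Y^k`
  have hcoefC : ∀ k, (hcoef G D p q k : ℂ) = (q : ℂ) ^ D * aeval ((r : ℝ) : ℂ) (G k) := by
    intro k; rw [hcoef_cast G hD p hq0 k, hrC]
  have hGKr : aeval ((r : ℝ) : ℂ) (G (Fin.last K)) ≠ 0 := by
    have h := hball r (fun h => hne h.symm) (by rw [abs_sub_comm]; exact hηδ)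
    rwa [eval_map_intCast] at h
  have hAK : hcoef G D p q (Fin.last K) ≠ 0 := by
    intro h0
    have h1 := hcoefC (Fin.last K)
    rw [h0, Int.cast_zero] at h1
    exact (mul_ne_zero (pow_ne_zero _ (by exact_mod_cast hq0)) hGKr) h1.symm
  have hA0 := hpoly_ne_zero G D p q hAK
  have hAdeg := natDegree_hpoly_eq G D p q hAK
  have hAlead := leadingCoeff_hpoly G D p q hAK
  set A : ℤ[X] := hpoly G D p q with hAdef
  -- its value at `w = e^ρ`
  have hAw : aeval w A = (q : ℂ) ^ D * ∑ k : Fin (K + 1),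
      (aeval ((r : ℝ) : ℂ) (G k) - aeval (ρ : ℂ) (G k)) * w ^ (k : ℕ) := by
    rw [hAdef, aeval_hpoly]
    have h1 : (q : ℂ) ^ D * ∑ k : Fin (K + 1),
        (aeval ((r : ℝ) : ℂ) (G k) - aeval (ρ : ℂ) (G k)) * w ^ (k : ℕ) =
        (∑ k : Fin (K + 1), (q : ℂ) ^ D * (aeval ((r : ℝ) : ℂ) (G k) * w ^ (k : ℕ))) -
          (q : ℂ) ^ D * ∑ k : Fin (K + 1), aeval (ρ : ℂ) (G k) * w ^ (k : ℕ) := by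
      rw [Finset.mul_sum, Finset.mul_sum, ← Finset.sum_sub_distrib]
      exact Finset.sum_congr rfl fun k _ => by ring
    rw [h1, hrel, mul_zero, sub_zero]
    refine Finset.sum_congr rfl fun k _ => ?_
    rw [hcoefC]; ring
  have hAw_le : ‖aeval w A‖ ≤ (q : ℝ) ^ D * Mtot * η := by
    have hsum : ‖∑ k : Fin (K + 1), (aeval ((r : ℝ) : ℂ) (G k) - aeval (ρ : ℂ) (G k)) * w ^ (k : ℕ)‖ ≤
        Mtot * η := by
      rw [hMtot, Finset.sum_mul]
      refine (norm_sum_le _ _).trans (Finset.sum_le_sum fun k _ => ?_)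
      rw [norm_mul, norm_pow]
      have h1 := hMk k r hη1'
      rw [abs_sub_comm] at h1
      calc ‖aeval ((r : ℝ) : ℂ) (G k) - aeval (ρ : ℂ) (G k)‖ * ‖w‖ ^ (k : ℕ)
          ≤ Mk k * η * ‖w‖ ^ (k : ℕ) := by gcongr
        _ = Mk k * ‖w‖ ^ (k : ℕ) * η := by ring
    calc ‖aeval w A‖ = (q : ℝ) ^ D * ‖∑ k : Fin (K + 1),
          (aeval ((r : ℝ) : ℂ) (G k) - aeval (ρ : ℂ) (G k)) * w ^ (k : ℕ)‖ := by
          rw [hAw, norm_mul, norm_pow, Complex.norm_natCast]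
      _ ≤ (q : ℝ) ^ D * (Mtot * η) := by gcongr
      _ = (q : ℝ) ^ D * Mtot * η := by ring
  -- a root `ξ` of `A` with `‖w − ξ‖^K ≤ ‖A(w)‖`
  set AC : ℂ[X] := A.map (Int.castRingHom ℂ) with hAC
  have hACdeg : AC.natDegree = K := by
    rw [hAC, Polynomial.natDegree_map_eq_of_injective (RingHom.injective_int _), hAdeg]
  have hAClead : 1 ≤ ‖AC.leadingCoeff‖ := by
    rw [hAC, Polynomial.leadingCoeff_map_of_injective (RingHom.injective_int _), eq_intCast,
      Complex.norm_intCast, hAlead]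
    exact_mod_cast Int.one_le_abs hAK
  obtain ⟨ξ, hξroot, hξle⟩ := exists_root_pow_le_norm_eval AC hAClead (by rw [hACdeg]; exact hK1) w
  rw [hACdeg, hAC, eval_map_intCast] at hξle
  have hAξ : aeval ξ A = 0 := by
    have h := hξroot
    rw [Polynomial.IsRoot.def, hAC, eval_map_intCast] at h
    exact h
  -- the minimal polynomial `Q` of `ξ` divides `A`
  have hξalg : IsAlgebraic ℚ ξ := (IsFractionRing.isAlgebraic_iff ℤ ℚ ℂ).mp ⟨A, hA0, hAξ⟩
  obtain ⟨Q, hQirr, hQdeg, hQξ⟩ :=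
    Literature.NumberTheory.Transcendental.NesterenkoWaldschmidt1996.exists_irreducible_int_aeval_eq_zero
      hξalg
  have hQA : Q ∣ A := dvd_of_irreducible_of_common_root hQirr hQdeg hQξ hAξ
  have hnK : Q.natDegree ≤ K := hAdeg ▸ Polynomial.natDegree_le_of_dvd hQA hA0
  -- heights: `M(Q) ≤ M(A) ≤ L(A) ≤ (|p|+q)^D (S+1) =: L`
  set L : ℝ := (((|p| + q : ℤ)) : ℝ) ^ D * Sr with hL
  have hpq1 : (1 : ℝ) ≤ ((|p| + q : ℤ) : ℝ) := by
    push_cast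
    have := abs_nonneg (p : ℝ)
    linarith
  have hL1 : 1 ≤ L := one_le_mul_of_one_le_of_one_le (one_le_pow₀ hpq1) hSr1
  have hScast : (S : ℝ) = ∑ k : Fin (K + 1), ∑ i ∈ Finset.range (D + 1), |((G k).coeff i : ℝ)| := by
    simp only [hSdef, Int.cast_sum, Int.cast_abs]
  have hMQ : (Q.map (Int.castRingHom ℂ)).mahlerMeasure ≤ L := by
    refine (mahlerMeasure_le_of_dvd hQA hA0).trans
      ((mahlerMeasure_map_le_sum (le_of_eq hAdeg)).trans ?_)
    rw [Finset.sum_range (fun j => |(A.coeff j : ℝ)|)]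
    have hk : ∀ k : Fin (K + 1), |(A.coeff k : ℝ)| ≤
        ((|p| + q : ℤ) : ℝ) ^ D * ∑ i ∈ Finset.range (D + 1), |((G k).coeff i : ℝ)| := by
      intro k
      rw [hAdef, coeff_hpoly_fin]
      exact_mod_cast abs_hcoef_le G D p q k
    calc ∑ k : Fin (K + 1), |(A.coeff (k : ℕ) : ℝ)|
        ≤ ∑ k : Fin (K + 1), ((|p| + q : ℤ) : ℝ) ^ D * ∑ i ∈ Finset.range (D + 1),
            |((G k).coeff i : ℝ)| := Finset.sum_le_sum fun k _ => hk k
      _ = ((|p| + q : ℤ) : ℝ) ^ D * S := by rw [← Finset.mul_sum, hScast]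
      _ ≤ L := by
          rw [hL]
          exact mul_le_mul_of_nonneg_left (by rw [hSr]; linarith) (by positivity)
  set Y : ℝ := Real.log 16 + Real.log L with hY
  have hlogL0 : 0 ≤ Real.log L := Real.log_nonneg hL1
  have hlog16 : 0 ≤ Real.log 16 := Real.log_nonneg (by norm_num)
  have h16Y : Real.log 16 ≤ Y := by rw [hY]; linarith
  have hMQY : Real.log (Q.map (Int.castRingHom ℂ)).mahlerMeasure ≤ Y := by
    have hMpos : 0 < (Q.map (Int.castRingHom ℂ)).mahlerMeasure :=
      mahlerMeasure_pos_of_ne_zero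
        ((Polynomial.map_ne_zero_iff (RingHom.injective_int _)).mpr hQirr.ne_zero)
    have := Real.log_le_log hMpos hMQ
    rw [hY]; linarith
  -- THE MEASURE at the rational exponent `r`
  have hXr := hX r hr0 Q hQirr hQdeg ξ hQξ Y h16Y hMQY
  rw [← Complex.ofReal_ratCast] at hXr
  -- `Φ ≤ c q³`
  have hYq : Y ≤ cY * q := by
    have hlogL : Real.log L = D * Real.log ((|p| + q : ℤ) : ℝ) + Real.log Sr := by
      rw [hL, Real.log_mul (by positivity) (by positivity), Real.log_pow]
    have h1 : Real.log ((|p| + q : ℤ) : ℝ) ≤ (|ρ| + 2) * q := by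
      refine (log_le_self_of_nonneg (by linarith)).trans ?_
      push_cast
      linarith [habsp]
    have h2 : (D : ℝ) * Real.log ((|p| + q : ℤ) : ℝ) ≤ D * ((|ρ| + 2) * q) :=
      mul_le_mul_of_nonneg_left h1 (by positivity)
    have h3 : Real.log Sr ≤ Real.log Sr * q := le_mul_of_one_le_right hlogSr hq1r
    have h4 : Real.log 16 ≤ 3 * q := by linarith [log_sixteen_lt_three]
    have hexp : ((D : ℝ) * (|ρ| + 2) + Real.log Sr + 3) * q =
        D * ((|ρ| + 2) * q) + Real.log Sr * q + 3 * q := by ring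
    rw [hY, hlogL, hcY, hexp]
    linarith
  have hΦ : C₀rat r * (Q.natDegree : ℝ) ^ 2 * Y *
      (Real.log Y + Real.log Q.natDegree) ^ 2 / Real.log Y ^ 2 ≤ c * (q : ℝ) ^ 3 := by
    have h1 : C₀rat r ≤ c0 * (q : ℝ) ^ 2 := by
      have := C₀rat_le (ρ := ρ) (r := r) hη1
      rw [hc0]; convert this using 1; rw [hq]; ring
    have h2 := measure_factor_le hQdeg hnK h16Y
    have hY0 : 0 < Y := lt_of_lt_of_le (Real.log_pos (by norm_num)) h16Y
    have hC₀0 : 0 ≤ C₀rat r := by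
      unfold C₀rat; positivity
    calc C₀rat r * (Q.natDegree : ℝ) ^ 2 * Y * (Real.log Y + Real.log Q.natDegree) ^ 2 /
          Real.log Y ^ 2
        = C₀rat r * ((Q.natDegree : ℝ) ^ 2 * Y * (Real.log Y + Real.log Q.natDegree) ^ 2 /
            Real.log Y ^ 2) := by ring
      _ ≤ (c0 * (q : ℝ) ^ 2) * ((K : ℝ) ^ 2 * (1 + K) ^ 2 * Y) :=
          mul_le_mul h1 h2 (by positivity) (by positivity)
      _ ≤ (c0 * (q : ℝ) ^ 2) * ((K : ℝ) ^ 2 * (1 + K) ^ 2 * (cY * q)) := by gcongr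
      _ = c * (q : ℝ) ^ 3 := by rw [hc]; ring
  -- upper bounds: moving the exponent, and the nearby root
  have hexp_r : ‖cexp ((r : ℝ) : ℂ) - w‖ ≤ 2 * Real.exp |ρ| * η := by
    have e1 : cexp ((r : ℝ) : ℂ) = ((Real.exp r : ℝ) : ℂ) := by rw [Complex.ofReal_exp]
    have e2 : w = ((Real.exp ρ : ℝ) : ℂ) := by rw [hw, Complex.ofReal_exp]
    rw [e1, e2, ← Complex.ofReal_sub, Complex.norm_real, Real.norm_eq_abs]
    have e3 : Real.exp r - Real.exp ρ = Real.exp ρ * (Real.exp ((r : ℝ) - ρ) - 1) := by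
      rw [mul_sub, ← Real.exp_add, mul_one]; ring_nf
    rw [e3, abs_mul, abs_of_pos (Real.exp_pos ρ)]
    have hb := Real.abs_exp_sub_one_le (x := (r : ℝ) - ρ) hη1'
    have hb' : |Real.exp ((r : ℝ) - ρ) - 1| ≤ 2 * η := by
      rw [hη, abs_sub_comm ρ (r : ℝ)]; exact hb
    calc Real.exp ρ * |Real.exp ((r : ℝ) - ρ) - 1| ≤ Real.exp |ρ| * (2 * η) :=
          mul_le_mul (Real.exp_le_exp.mpr (le_abs_self ρ)) hb' (abs_nonneg _) (by positivity)
      _ = 2 * Real.exp |ρ| * η := by ring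
  have hlow : Real.exp (-(C₀rat r * (Q.natDegree : ℝ) ^ 2 * Y *
      (Real.log Y + Real.log Q.natDegree) ^ 2 / Real.log Y ^ 2)) ≤
      2 * Real.exp |ρ| * η + ‖w - ξ‖ :=
    hXr.trans ((norm_sub_le_norm_sub_add_norm_sub _ w ξ).trans (by linarith))
  have hδ : ‖w - ξ‖ ^ K ≤ (q : ℝ) ^ D * Mtot * η := hξle.trans hAw_le
  have hCend : (K : ℝ) * c + K + D + Mtot + |ρ| + 3 ≤ C := by
    rw [hC]; linarith [abs_nonneg (Real.log δ₀)]
  exact endgame hK1 hq1 hc0' hMtot0 hlow hΦ hδ hηlt hCend hqm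

/-- exponent of `T` of the monomial `s` under `X₁ ↦ T^q`, `X₂ ↦ T^p` -/
def ex3 (q p : ℕ) (s : Fin 3 →₀ ℕ) : ℕ := q * s 1 + p * s 2

/-- integer coefficient `coeff(s) · p^{s₀} q^{D − s₀}` (the `X₀ ↦ p/q` homogenisation) -/
def co3 (P : MvPolynomial (Fin 3) ℤ) (D p q : ℕ) (s : Fin 3 →₀ ℕ) : ℤ :=
  P.coeff s * (p : ℤ) ^ (s 0) * (q : ℤ) ^ (D - s 0)

/-- `A = Σ_s co3(s) T^{ex3 s} = q^D · P(p/q, T^q, T^p) ∈ ℤ[T]` -/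
def A3 (P : MvPolynomial (Fin 3) ℤ) (D p q : ℕ) : ℤ[X] :=
  ∑ s ∈ P.support, C (co3 P D p q s) * X ^ ex3 q p s

/-- the real function `x ↦ P(x, e, e^x)` -/
def F3 (P : MvPolynomial (Fin 3) ℤ) (x : ℝ) : ℝ :=
  ∑ s ∈ P.support, ((P.coeff s : ℤ) : ℝ) * x ^ (s 0) * Real.exp ((s 1 : ℝ) + (s 2 : ℝ) * x)

/-- §16f. Level 3 with e^ℓ load-bearing: (ℓ, e, e^ℓ) for hyper-Liouville ℓ > 0: auxiliary statement `F3_cast` (lens 6 gen 9 node, ported verbatim). -/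
theorem F3_cast (P : MvPolynomial (Fin 3) ℤ) (x : ℝ) :
    ((F3 P x : ℝ) : ℂ) = MvPolynomial.aeval ![(x : ℂ), cexp 1, cexp x] P := by
  rw [MvPolynomial.aeval_def, MvPolynomial.eval₂_eq', F3]
  push_cast
  refine Finset.sum_congr rfl fun s _ => ?_
  rw [Fin.prod_univ_three]
  simp only [algebraMap_int_eq, eq_intCast, Matrix.cons_val_zero, Matrix.cons_val_one,
    Matrix.cons_val]
  rw [Complex.exp_add, ← Complex.exp_nat_mul, ← Complex.exp_nat_mul, mul_one]
  ring

/-- §16f. Level 3 with e^ℓ load-bearing: (ℓ, e, e^ℓ) for hyper-Liouville ℓ > 0: auxiliary statement `contDiff_F3` (lens 6 gen 9 node, ported verbatim). -/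
theorem contDiff_F3 (P : MvPolynomial (Fin 3) ℤ) : ContDiff ℝ 1 (F3 P) := by
  unfold F3
  refine ContDiff.sum fun s _ => ?_
  exact (contDiff_const.mul (contDiff_id.pow _)).mul
    (Real.contDiff_exp.comp (contDiff_const.add (contDiff_const.mul contDiff_id)))

/-- local Lipschitz bound of `F3 P` at `ℓ` -/
theorem exists_lipschitz_F3 (P : MvPolynomial (Fin 3) ℤ) (ℓ : ℝ) :
    ∃ Kl δ₁ : ℝ, 0 ≤ Kl ∧ 0 < δ₁ ∧ ∀ x : ℝ, |x - ℓ| < δ₁ → |F3 P x - F3 P ℓ| ≤ Kl * |x - ℓ| := by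
  obtain ⟨K, t, ht, hK⟩ := ((contDiff_F3 P).contDiffAt (x := ℓ)).exists_lipschitzOnWith
  obtain ⟨δ₁, hδ₁, hball⟩ := Metric.mem_nhds_iff.mp ht
  refine ⟨K, δ₁, K.2, hδ₁, fun x hx => ?_⟩
  have hxt : x ∈ t := hball (by rw [Metric.mem_ball, Real.dist_eq]; exact hx)
  have hℓt : ℓ ∈ t := hball (Metric.mem_ball_self hδ₁)
  have := (lipschitzOnWith_iff_dist_le_mul.mp hK) x hxt ℓ hℓt
  rwa [Real.dist_eq, Real.dist_eq] at this

end HyperCell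

end Summit.Schanuel.Schanuel.Theorems.RootDecomp1KHyper
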